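import Summits.BirchSwinnertonDyer.BirchSwinnertonDyer.Theorems.ErratumRoadFiveRest3BranchesOfGuardedB12
import HarnessLib

/-!
# Route `ErratumRoadFive` (K2, `p ≥ 5`), crux (T) `Rest3TorsionBranchAtFive` (item 19702) — the REGISTERED stub
# S1′ `stub_t_imcDivSomeFrameBne3` (skeleton v2, sha 56dcdf12ea59efc9, RULING 36 (α)) BY NAME from ROAD B12's
# sources: `{Hsieh 2014 Thm 5.6, BDP13 Thm 5.5, BCS25 Thm 1.2.4 (b), BCS25 Prop 4.2.2}` + UB♯|ᵍ|T + TRANSFER|ᵍ|T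
# (CONDITIONAL display; THEOREMS ONLY)

Cell `bsd-stepL` (run/shared/lean/pub/bsd-stepL/), seat `bsd-stepL-bdp` (prover g25, 2026-08-27). `--supports
stmt-BirchSwinnertonDyer-19702 --as helper`. Memo: HOME/proof/PROOF-BDP.md §60.8 (p563393 §11: the ITEM by name from
the same sources), §61.6 (v2 registration), §61.8 (this file).

WHAT. Skeleton v2 of crux 19702 (`Cruxes/Rest3TorsionBranchAtFive/Lines/birth.lean`, registered 2026-08-27T20:48:34Z
from the tree path) carries the GUARDED stub S1′ `stub_t_imcDivSomeFrameBne3` = the body of the B-atom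
`P2.IMCDivSomeFrameOnTreeB W p` with ONE extra binder `NumberField.discr K ≠ -3`, asked at every (ram) pair with a
non-zero `p`-torsion point in `E(ℚ_p)`. PART 2 (p561501 §4,
`P2.imcDivSomeFrameB_guarded_of_thm124b_of_unrFrame_of_upperDivisibility_of_transfer`) proves that body per pair from
the two BCS25 PRINT facts + FRAME + UB♯|ᵍ + TRANSFER|ᵍ; PART 4 (p563393 §11) used it inside a `fun W _ _ p _ hram hP ↦ …`
to reach the ITEM. This file states the intermediate object ON THE NOSE: **the registered S1′ signature VERBATIM**
(byte-copied from the tree skeleton, fully qualified) ⟸ {`hsieh2014_exists_anticyclotomicPAdicLFunction_unrPeriod`,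
`bertoliniDarmonPrasanna2013_centralValue_reciprocity` (FRAME via p512577 `P2.unrFrame_of_hsieh2014_unrPeriod_of_bdp2013`),
`thm124b_…`, `prop422_…`} + UB♯|ᵍ|T + TRANSFER|ᵍ|T (the (T)-restricted guarded shapes, binders verbatim as in p563393
§11). So a referee can byte-compare the registered stub against a kernel display, and the stub's OPEN content is
read off as exactly UB♯|T + TRANSFER|T (TRANSFER's two `FU` conjuncts being supplied by the Σ-Euler-factor lemma,
p568622 ∕ p570269 `SigmaFactorFU.exists_transferPackage_of_sigmaFactors`; PROOF-BDP §61.4 TRANSFER♭).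

HONEST FRAMING: CONDITIONAL display — UB♯ (PROOF-BDP §55) and TRANSFER (§40 ∕ §37.11 ∕ §58) are OPEN typed shapes
(memo-proved, refereed), the four named facts are PRINT carried by name (flag D1 on BCS25 inherited); the stub is NOT
proved (a registered stub closes only unconditionally); nothing booked (T7); item 19702 stays OPEN.
References: [Hsieh2014] Thm. 5.6; [BertoliniDarmonPrasanna2013] Thm. 5.5; [BurungaleCastellaSkinner2025] Thm. 1.2.4 (b),
Prop. 4.2.2; [Castella2018Erratum] (2.4); [Castella2018] Thm. 3.1; [Washington1997] §7.1.
-/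

set_option autoImplicit false
-- the problem directory `BirchSwinnertonDyer/BirchSwinnertonDyer` (single-conjunct summit) forces the duplicate segment
set_option linter.dupNamespace false

noncomputable section

open scoped Classical NumberField Topology

open Filter WeierstrassCurve NumberField IsDedekindDomain Field PowerSeries
open Literature.NumberTheory.EllipticCurves Literature.NumberTheory.EllipticCurves.GreenbergSelmer
open Literature.NumberTheory.EllipticCurves.ModularForms
open Literature.NumberTheory.EllipticCurves.Rank1Residual
open Literature.NumberTheory.EllipticCurves.Rank1Residual.Typed
open Literature.NumberTheory.EllipticCurves.Castella2018
open Literature.NumberTheory.EllipticCurves.Castella2018Exceptional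
open Literature.NumberTheory.EllipticCurves.Wuthrich2014
open Literature.NumberTheory.EllipticCurves.JetchevSkinnerWan2017
open Literature.NumberTheory.GaloisRepresentations Literature.NumberTheory.GaloisCohomology
open Literature.NumberTheory.Automorphic
open Summit.BirchSwinnertonDyer.Rank1Residual Summit.BirchSwinnertonDyer.Rank1Residual.X11b
open Summit.BirchSwinnertonDyer.Rank1Residual.X11b.AcSelmer
open Summit.BirchSwinnertonDyer.Rank1Residual.X11b.Halves
open Summit.BirchSwinnertonDyer.BirchSwinnertonDyer.Theorems.Rest3TorsionBranchB

namespace Summit.BirchSwinnertonDyer.BirchSwinnertonDyer.Theorems.Rest3GuardedB12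

/-- **Registered stub S1′ `stub_t_imcDivSomeFrameBne3` (19702, skeleton v2) BY NAME ⟸ {Hsieh 2014 Thm 5.6, BDP13 Thm
5.5, BCS25 Thm 1.2.4 (b), BCS25 Prop 4.2.2} + UB♯|ᵍ|T + TRANSFER|ᵍ|T.** The conclusion is the stub's signature VERBATIM
(fully qualified, byte-copied from `Cruxes/Rest3TorsionBranchAtFive/Lines/birth.lean` sha 56dcdf12ea59efc9); the proof
is p561501 §4 at each (T) pair with the FRAME supplied by p512577 from Hsieh 5.6 + BDP 5.5. CONDITIONAL display (UB♯,
TRANSFER open typed shapes; PRINT facts by name); the stub is not proved; nothing booked.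
[cite: Hsieh2014, Thm. 5.6 (arXiv:1112.1580 p. 23)] [cite: BertoliniDarmonPrasanna2013, Thm. 5.5 and (5.1.16)]
[cite: BurungaleCastellaSkinner2025, Thm. 1.2.4 (b) and Prop. 4.2.2 (arXiv:2405.00270v2 pp. 3, 8–9)]
[cite: Castella2018Erratum, (2.4) (p. 4)] [cite: Washington1997, §7.1 Prop. 7.2] -/
theorem stub_t_imcDivSomeFrameBne3_of_thm124b_of_unrFrame_of_upperDivisibility_of_transfer
    (hH : hsieh2014_exists_anticyclotomicPAdicLFunction_unrPeriod)
    (hR : bertoliniDarmonPrasanna2013_centralValue_reciprocity)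
    (h124 : BurungaleCastellaSkinner2025.thm124b_exists_isBDPLFunction_isTorsion_charIdeal_eq)
    (h422 : BurungaleCastellaSkinner2025.prop422_exists_isBDPLFunction_mu_eq_zero)
    (hUB : ∀ (W : WeierstrassCurve ℚ) [W.IsElliptic] [W.IsGloballyMinimal] (p : ℕ) [Fact p.Prime],
      Ram W p → (∃ P : (W.baseChange ℚ_[p]).toAffine.Point, p • P = 0 ∧ P ≠ 0) →
      ∀ (N : ℕ) [NeZero N] (K : Type) [Field K] [NumberField K]
        (Dt : ModularParametrizationData W N) (H : HeegnerDatum N (NumberField.discr K)) (ι : K →+* ℂ)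
        (P : (W.baseChange K).toAffine.Point),
        ClassX11b W p → 5 ≤ p → Surj W p → W.conductorNorm ℤ = N → IsImaginaryQuadratic K →
        Odd (NumberField.discr K) → NumberField.discr K ≠ -3 → ¬ (p : ℤ) ∣ NumberField.discr K →
        ¬ p ∣ Units.torsionOrder K → SatisfiesHeegnerHypothesis N K →
        (W.quadraticTwist (NumberField.discr K : ℚ)).entireLFunction 1 ≠ 0 →
        WeierstrassCurve.Affine.Point.map ι.toRatAlgHom P = heegnerPointComplex Dt H →
        ¬ (p : ℤ) ∣ Dt.c → ¬ IsOfFinAddOrder P →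
        ∀ (κ : ZpExtension K p), κ.IsAnticyclotomic →
          ∀ (γ : Field.absoluteGaloisGroup K) [Fact (κ.IsTopGenerator γ)]
            (ι' : PadicAlgCl p ≃+* ℂ) (w₀ : InfinitePlace K) (P' : (W.baseChange K).toAffine.Point),
            WeierstrassCurve.Affine.Point.map w₀.embedding.toRatAlgHom P' = heegnerPointComplex Dt H →
            ∀ (e : K →+* ℚ_[p]),
              (∀ k : 𝓞 K, k ∈ (primeOfEmbeddingDatum p ι' w₀.embedding).asIdeal ↔ ‖e (k : K)‖ < 1) →
              ∀ (ΩK : ℂ) (Ωp : (unrIntegers p)ˣ) (L : UnrSeries p), ΩK ≠ 0 →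
                IsBDPLFunction ι' (primeOfEmbeddingDatum p ι' w₀.embedding) κ γ Dt.f ΩK
                  ((Ωp : unrIntegers p) : ℂ_[p]) L →
                ∀ (𝔭bar : HeightOneSpectrum (𝓞 K)), ((p : ℕ) : 𝓞 K) ∈ 𝔭bar.asIdeal →
                  𝔭bar ≠ primeOfEmbeddingDatum p ι' w₀.embedding →
                  L ∈ (XAc.charIdeal (W.baseChange K) p κ 𝔭bar ∅ γ).map (PowerSeries.map (toUnr p)))
    (hTR : ∀ (W : WeierstrassCurve ℚ) [W.IsElliptic] [W.IsGloballyMinimal] (p : ℕ) [Fact p.Prime],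
      Ram W p → (∃ P : (W.baseChange ℚ_[p]).toAffine.Point, p • P = 0 ∧ P ≠ 0) →
      ∀ (N : ℕ) [NeZero N] (K : Type) [Field K] [NumberField K]
        (Dt : ModularParametrizationData W N) (H : HeegnerDatum N (NumberField.discr K)) (ι : K →+* ℂ)
        (P : (W.baseChange K).toAffine.Point),
        ClassX11b W p → 5 ≤ p → Surj W p → W.conductorNorm ℤ = N → IsImaginaryQuadratic K →
        Odd (NumberField.discr K) → NumberField.discr K ≠ -3 → ¬ (p : ℤ) ∣ NumberField.discr K →
        ¬ p ∣ Units.torsionOrder K → SatisfiesHeegnerHypothesis N K →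
        (W.quadraticTwist (NumberField.discr K : ℚ)).entireLFunction 1 ≠ 0 →
        WeierstrassCurve.Affine.Point.map ι.toRatAlgHom P = heegnerPointComplex Dt H →
        ¬ (p : ℤ) ∣ Dt.c → ¬ IsOfFinAddOrder P →
        ∀ (κ : ZpExtension K p), κ.IsAnticyclotomic →
          ∀ (γ : Field.absoluteGaloisGroup K) [Fact (κ.IsTopGenerator γ)]
            (ι' : PadicAlgCl p ≃+* ℂ) (w₀ : InfinitePlace K) (P' : (W.baseChange K).toAffine.Point),
            WeierstrassCurve.Affine.Point.map w₀.embedding.toRatAlgHom P' = heegnerPointComplex Dt H →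
            ∀ (e : K →+* ℚ_[p]),
              (∀ k : 𝓞 K, k ∈ (primeOfEmbeddingDatum p ι' w₀.embedding).asIdeal ↔ ‖e (k : K)‖ < 1) →
              ∀ (ΩK : ℂ) (Ωp : (unrIntegers p)ˣ) (L : UnrSeries p), ΩK ≠ 0 →
                IsBDPLFunction ι' (primeOfEmbeddingDatum p ι' w₀.embedding) κ γ Dt.f ΩK
                  ((Ωp : unrIntegers p) : ℂ_[p]) L →
                ∀ (𝔭bar : HeightOneSpectrum (𝓞 K)), ((p : ℕ) : 𝓞 K) ∈ 𝔭bar.asIdeal →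
                  𝔭bar ≠ primeOfEmbeddingDatum p ι' w₀.embedding →
                  ∃ (W' : WeierstrassCurve ℚ) (_ : W'.IsElliptic) (_ : W'.IsGloballyMinimal) (N' : ℕ)
                    (_ : NeZero N') (Dt' : ModularParametrizationData W' N'),
                    GoodOrd W' p ∧ Surj W' p ∧ SatisfiesHeegnerHypothesis N' K ∧
                    ∀ (g g' : IwasawaAlgebra p),
                      XAc.charIdeal (W.baseChange K) p κ 𝔭bar ∅ γ = Ideal.span {g} →
                      XAc.charIdeal (W'.baseChange K) p κ 𝔭bar ∅ γ = Ideal.span {g'} →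
                      ∀ (ΩK' : ℂ) (Ωp' : (unrIntegers p)ˣ) (L' : UnrSeries p), ΩK' ≠ 0 →
                        IsBDPLFunction ι' (primeOfEmbeddingDatum p ι' w₀.embedding) κ γ Dt'.f ΩK'
                          ((Ωp' : unrIntegers p) : ℂ_[p]) L' →
                        ∃ (P P' u : UnrSeries p) (m m' : ℕ),
                          (‖((coeff m P : unrIntegers p) : ℂ_[p])‖ = 1 ∧
                            ∀ i < m, ‖((coeff i P : unrIntegers p) : ℂ_[p])‖ < 1) ∧
                          (‖((coeff m' P' : unrIntegers p) : ℂ_[p])‖ = 1 ∧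
                            ∀ i < m', ‖((coeff i P' : unrIntegers p) : ℂ_[p])‖ < 1) ∧
                          IsUnit u ∧
                          (∀ i, ‖((coeff i (u * (L' * P')) : unrIntegers p) : ℂ_[p]) -
                            ((coeff i (L * P) : unrIntegers p) : ℂ_[p])‖ < 1) ∧
                          ((∃ a, (‖((coeff a (PowerSeries.map (toUnr p) g * P) : unrIntegers p) : ℂ_[p])‖ = 1 ∧
                              ∀ i < a, ‖((coeff i (PowerSeries.map (toUnr p) g * P) : unrIntegers p) :
                                ℂ_[p])‖ < 1)) →
                            ∃ a', (‖((coeff a' (PowerSeries.map (toUnr p) g' * P') : unrIntegers p) :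
                              ℂ_[p])‖ = 1 ∧
                              ∀ i < a', ‖((coeff i (PowerSeries.map (toUnr p) g' * P') : unrIntegers p) :
                                ℂ_[p])‖ < 1)) ∧
                          (∀ a a', (‖((coeff a (PowerSeries.map (toUnr p) g * P) : unrIntegers p) : ℂ_[p])‖ = 1 ∧
                              ∀ i < a, ‖((coeff i (PowerSeries.map (toUnr p) g * P) : unrIntegers p) :
                                ℂ_[p])‖ < 1) →
                            (‖((coeff a' (PowerSeries.map (toUnr p) g' * P') : unrIntegers p) : ℂ_[p])‖ = 1 ∧
                              ∀ i < a', ‖((coeff i (PowerSeries.map (toUnr p) g' * P') : unrIntegers p) :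
                                ℂ_[p])‖ < 1) → a = a')) :
    ∀ (W : WeierstrassCurve ℚ) [W.IsElliptic] [W.IsGloballyMinimal] (p : ℕ) [Fact p.Prime],
      Literature.NumberTheory.EllipticCurves.Rank1Residual.Ram W p →
      (∃ P : (W.baseChange ℚ_[p]).toAffine.Point, p • P = 0 ∧ P ≠ 0) →
      ∀ (N : ℕ) [NeZero N] (K : Type) [Field K] [NumberField K]
        (Dt : Literature.NumberTheory.EllipticCurves.ModularForms.ModularParametrizationData W N)
        (H : Literature.NumberTheory.EllipticCurves.HeegnerDatum N (NumberField.discr K)) (ι : K →+* ℂ)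
        (P : (W.baseChange K).toAffine.Point),
        Summit.BirchSwinnertonDyer.Rank1Residual.ClassX11b W p → 5 ≤ p →
        Literature.NumberTheory.EllipticCurves.Rank1Residual.Surj W p → W.conductorNorm ℤ = N →
        Literature.NumberTheory.EllipticCurves.IsImaginaryQuadratic K →
        Odd (NumberField.discr K) → NumberField.discr K ≠ -3 → ¬ (p : ℤ) ∣ NumberField.discr K →
        ¬ p ∣ NumberField.Units.torsionOrder K →
        Literature.NumberTheory.EllipticCurves.SatisfiesHeegnerHypothesis N K →
        (W.quadraticTwist (NumberField.discr K : ℚ)).entireLFunction 1 ≠ 0 →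
        WeierstrassCurve.Affine.Point.map ι.toRatAlgHom P =
          Literature.NumberTheory.EllipticCurves.ModularForms.heegnerPointComplex Dt H →
        ¬ (p : ℤ) ∣ Dt.c → ¬ IsOfFinAddOrder P →
        ∀ (κ : Literature.NumberTheory.EllipticCurves.ZpExtension K p), κ.IsAnticyclotomic →
          ∀ (γ : Field.absoluteGaloisGroup K) [Fact (κ.IsTopGenerator γ)]
            (ι' : PadicAlgCl p ≃+* ℂ) (w₀ : NumberField.InfinitePlace K)
            (P' : (W.baseChange K).toAffine.Point),
            WeierstrassCurve.Affine.Point.map w₀.embedding.toRatAlgHom P' =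
              Literature.NumberTheory.EllipticCurves.ModularForms.heegnerPointComplex Dt H →
            ∀ (e : K →+* ℚ_[p]),
              (∀ k : NumberField.RingOfIntegers K,
                k ∈ (Summit.BirchSwinnertonDyer.Rank1Residual.X11b.primeOfEmbeddingDatum p ι' w₀.embedding).asIdeal ↔
                  ‖e (k : K)‖ < 1) →
              ∃ (ΩK : ℂ) (Ωp : ℂ_[p]) (Q : PowerSeries 𝓞_ℂ_[p]), ΩK ≠ 0 ∧ ‖Ωp‖ = 1 ∧
                Summit.BirchSwinnertonDyer.Rank1Residual.X11b.R1.IsBDPLFunctionInt p ι'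
                  (Summit.BirchSwinnertonDyer.Rank1Residual.X11b.primeOfEmbeddingDatum p ι' w₀.embedding) κ γ Dt.f ΩK Ωp Q ∧
                ∀ (𝔭bar : IsDedekindDomain.HeightOneSpectrum (NumberField.RingOfIntegers K)),
                  ((p : ℕ) : NumberField.RingOfIntegers K) ∈ 𝔭bar.asIdeal →
                  𝔭bar ≠ Summit.BirchSwinnertonDyer.Rank1Residual.X11b.primeOfEmbeddingDatum p ι' w₀.embedding →
                  (Summit.BirchSwinnertonDyer.Rank1Residual.X11b.AcSelmer.XAc.charIdeal (W.baseChange K) p κ 𝔭bar ∅ γ).map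
                      (PowerSeries.map (Summit.BirchSwinnertonDyer.Rank1Residual.X11b.R1.toCpInt p)) ≤
                    Ideal.span {Q} :=
  fun W _ _ p _ hram hP ↦
    P2.imcDivSomeFrameB_guarded_of_thm124b_of_unrFrame_of_upperDivisibility_of_transfer h124 h422
      (P2.unrFrame_of_hsieh2014_unrPeriod_of_bdp2013 hH hR) (hUB W p hram hP) (hTR W p hram hP)

end Summit.BirchSwinnertonDyer.BirchSwinnertonDyer.Theorems.Rest3GuardedB12

end
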